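import Literature.Geometry.Kaehler.ComplexTorusFrameFirstOrder
import Literature.Geometry.Kaehler.ComplexTorusPicardGroup
import Literature.Geometry.Kaehler.ComplexTorusAppellHumbertTranslation
import Literature.Geometry.Kaehler.ComplexTorusAppellHumbertInjective
import HarnessLib

/-!
# First-order rigidity of translations for a positive line bundle on a complex torus
# (`dφ_L = H` is injective for a Riemann form `H`; Lange 2023, Thm. 1.4.15; Mumford §13)

Layer `Literature/Geometry/Kaehler`, namespace `Literature.Geometry.Kaehler.ComplexTorus`.  THEOREMS ONLY (no
definition, no named fact, no instance).  Setting: `X = V/Λ` (`ComplexTorus Φ`), the canonical factors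
`a_{(H,χ)} = canonicalFactor Φ η χ` of the Appell–Humbert data (`η = Im H`, `hermOf η = H`), Riemann forms
(`IsRiemannForm Φ η`: type `(1,1)`, integral on `Λ`, `H > 0`), and holomorphic line bundles `L` on `X` with frames
`s` of `π^*L` (`IsCoverFrame`, `ComplexTorusFrameFirstOrder`).

Lange, Thm. 1.4.15: «Suppose `X = V/Λ` and `f : X → X̂` is a homomorphism with analytic representation `F : V → Ω̄` …»
— for `f = φ_L`, `L = L(H, χ)`, the analytic representation is `v ↦ H(v, ·)` (Lemma 1.4.5 / §1.4.2: «`φ_L(v̄)` is the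
line bundle with canonical factor `a(λ, w) e(2πi Im H(v, λ))`», Exercise 1.3.4 (3)(b): `a(λ, v + w) = a(λ, v) e(π H(w, λ))`);
Mumford, *Abelian Varieties* §13 (proof of the Theorem, p. 125) computes the tangent map of `x ↦ t_x^*L ⊗ L⁻¹` at `0`
as `v ↦ {first-order variation of the cocycle of L along v} ∈ H¹(𝒪)`.  We prove the FIRST-ORDER (dual-number) form of
the injectivity of `dφ_L` for positive `H`, in three currencies:

* §1 `IsRiemannForm.eq_zero_of_hermOf_coboundary` — **a Riemann form has no first-order translational symmetry**: if
  for some `w ∈ V`, `c ≠ 0` and an entire `h` the CONSTANT cocycle `λ ↦ c·H(w, λ)` is the coboundary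
  `h(· + λ) − h` of `h`, then `w = 0` (Liouville makes `h − h(0)` the ℂ-linear `Dh(0)`, which agrees with the
  ℂ-ANTIlinear `c·H(w, ·)` on `Λ`, hence on `V`; so `H(w, ·) = 0`, and positivity at `w` gives `w = 0`);
  `…_of_hermOf_add_coboundary` (coboundary-slack form), and `…_of_deriv_canonicalFactor_translate_eq`
  (`d/ds|₀ a(λ, v + s w) = a(λ, v)(h(v + λ) − h(v)) ⇒ w = 0`, via `hasDerivAt_canonicalFactor_translate`:
  `d/ds|₀ a_{(H,χ)}(λ, v + s w) = a_{(H,χ)}(λ, v)·πH(w, λ)`).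
* §2 `IsCoverFrame.eq_zero_of_periodic_firstOrder_coboundary_of_refinement` — **cover form**: if `φ₁⁻¹ L = [a_p]` for an
  Appell–Humbert datum `p` whose form is a Riemann form, and on an open refinement `V_a ⊆ U_{k(a)}` of the trivialising
  cover the logarithmic `w`-derivatives of the transition functions are coboundaries of Λ-periodic holomorphic
  functions (`∂_w(g_{k(a)k(b)} ∘ π)/(g ∘ π) = H_b − H_a` on `π⁻¹(V_a ∩ V_b)`), then `w = 0`: the frame bookkeeping of
  `ComplexTorusFrameFirstOrder` makes `∂_w log e` a coboundary for the frame factor `e`; `e ∼ a_p` through an entire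
  zero-free `K` (`exists_coboundary_of_isTrivialOn_tensor_inv_of_isTrivialOn`), whose logarithmic derivative is the
  coboundary slack; §1 concludes.  `IsCoverFrame.eq_zero_of_periodic_firstOrder_coboundary` is the case `V_k = U_k`.

Consumer (cell `hodgecm-mathlib`): the Kodaira–Spencer injectivity of the Mumford family `Λ(𝒪(Θ))` at dual-number points
(`Θ` ample ⇒ `c₁(𝒪(Θ)^an)` is a Riemann form, `Motives/AbelianVarietyAmpleRiemannForm`).  Presearch: [corpus:
book:lange1992-complex-abelian-varieties chunks p0045 (Lemma 1.4.5), p0049 (Thm. 1.4.15), p0035 (Lemma 1.2.10)] — the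
statement `dφ_L = H`; the dual-number/coboundary phrasing is Mumford's §13 computation, not printed as a lemma; galaxy
«analytic representation|phi_L|first-order deformation»: no usable hit beyond these.  Mathlib searched and used:
`AddMonoidHom.toRealLinearMap`, `HasFDerivAt.unique`, `ContinuousLinearMap.restrictScalars`, `Pi.basisFun`/`Basis.ext`,
`HasDerivAt.cexp`, `Filter.EventuallyEq.fderiv_eq`.

## References
* H. Lange, *Abelian Varieties over the Complex Numbers*, Grundlehren Text Edition (2023): §1.2.1 Prop. 1.2.2–1.2.3
  (pp. 21–22), §1.2.2 Lemma 1.2.10 (p. 26), §1.3.2 Thm. 1.3.3 (p. 30), §1.3.4 Exercise (3)(b) (p. 33), §1.4.1 Prop. 1.4.1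
  (p. 36), §1.4.2 Lemma 1.4.5 (p. 38) and §1.4.4 Thm. 1.4.15 (p. 43). [Lange2023AbelianVarietiesComplex]
* D. Mumford, *Abelian Varieties* (1970), §13, proof of the Theorem (p. 125). [MumfordAV1970]
* L. Hörmander, *An Introduction to Complex Analysis in Several Variables* (1973), Thm. 2.2.1 (Osgood). [HormanderSCV1973]
-/

noncomputable section

open scoped Topology Manifold Real
open Set Filter Function Complex

namespace Literature.Geometry.Kaehler

namespace ComplexTorus

/-! ## §0 Calculus helpers (private) -/

section Calculus

variable {E : Type*} [NormedAddCommGroup E] [NormedSpace ℂ E]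

/-- Logarithmic derivative of a local product identity `f = g · h` near `z`:
`∂_v f / f = ∂_v g / g + ∂_v h / h` at `z`. [folklore] -/
private theorem fderiv_apply_div_eq_add_of_eventuallyEq_mul {f g h : E → ℂ} {z : E}
    (hfg : f =ᶠ[𝓝 z] fun y ↦ g y * h y) (hg : DifferentiableAt ℂ g z) (hh : DifferentiableAt ℂ h z) (hg0 : g z ≠ 0)
    (hh0 : h z ≠ 0) (v : E) : fderiv ℂ f z v / f z = fderiv ℂ g z v / g z + fderiv ℂ h z v / h z := by
  have hf : f z = g z * h z := hfg.eq_of_nhds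
  rw [hfg.fderiv_eq, fderiv_fun_mul hg hh, hf]
  rw [_root_.add_apply, _root_.smul_apply, _root_.smul_apply, smul_eq_mul, smul_eq_mul]
  field_simp
  ring

/-- The derivative of a translate: `∂_v (f(· + c))(z) = ∂_v f (z + c)`. [folklore] -/
private theorem fderiv_comp_add_right_apply (f : E → ℂ) (c z v : E) :
    fderiv ℂ (fun y ↦ f (y + c)) z v = fderiv ℂ f (z + c) v := by
  rw [fderiv_comp_add_right]

/-- Directional derivative as a one-variable derivative along the line `s ↦ z + s·v`. [folklore] -/
private theorem deriv_comp_line_eq_fderiv {f : E → ℂ} {z : E} (hf : DifferentiableAt ℂ f z) (v : E) :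
    deriv (fun s : ℂ ↦ f (z + s • v)) 0 = fderiv ℂ f z v := by
  have hl : HasDerivAt (fun s : ℂ ↦ z + s • v) v 0 := by
    simpa using ((hasDerivAt_id (0 : ℂ)).smul_const v).const_add z
  have h0 : z + (0 : ℂ) • v = z := by simp
  have hf' : HasFDerivAt f (fderiv ℂ f (z + (0 : ℂ) • v)) (z + (0 : ℂ) • v) := by
    rw [h0]; exact hf.hasFDerivAt
  have := hf'.comp_hasDerivAt (0 : ℂ) hl
  rw [h0] at this
  exact this.deriv

/-- Log-derivative of an entire zero-free function is entire (Osgood for `∂_w K`). [folklore] -/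
private theorem differentiable_fderiv_apply_div {K : E → ℂ} (hK : Differentiable ℂ K) (hK0 : ∀ v, K v ≠ 0) (w : E) :
    Differentiable ℂ (fun y ↦ fderiv ℂ K y w / K y) := by
  have h1 : Differentiable ℂ (fun y ↦ fderiv ℂ K y w) := fun y ↦
    (Literature.Analysis.Complex.SCV.differentiableOn_fderiv_apply hK.differentiableOn isOpen_univ w).differentiableAt
      Filter.univ_mem
  have heq : (fun y ↦ fderiv ℂ K y w / K y) = fun y ↦ fderiv ℂ K y w * (K y)⁻¹ := by
    funext y; rw [div_eq_mul_inv]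
  rw [heq]
  exact fun y ↦ (h1 y).mul ((hK y).inv (hK0 y))

end Calculus


section Heart

variable {ι : Type*} [Fintype ι] {E : Type*} [NormedAddCommGroup E] [NormedSpace ℂ E] (Φ : (ι → ℝ) ≃L[ℝ] E)

/-! ## §1 The heart: a Riemann form has no first-order translational symmetry

### Liouville step: an entire function with constant `Λ`-differences is affine ℂ-linear -/

omit [Fintype ι] in
/-- **Constant `Λ`-differences force affine linearity.**  If `h : V → ℂ` is entire and every difference
`h(v + λ) − h(v)`, `λ ∈ Λ`, is independent of `v`, then for every `u ∈ V` the difference `h(v + u) − h(v)` is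
independent of `v` as well (it is a `Λ`-periodic entire function — Liouville on the compact torus).
[cite: Lange2023AbelianVarietiesComplex, §1.3.2 Thm. 1.3.3 (Appell–Humbert, p. 30; proof p. 31: Liouville)] -/
theorem apply_add_sub_apply_eq_of_forall_latticeVec {h : E → ℂ} (hh : Differentiable ℂ h)
    (hc : ∀ (n : ι → ℤ) (v v' : E), h (v + latticeVec Φ n) - h v = h (v' + latticeVec Φ n) - h v')
    (u v : E) : h (v + u) - h v = h u - h 0 := by
  -- `q(v) := h(v + u) − h(v)` is a theta function for the trivial constant factor
  have hq : (fun v ↦ h (v + u) - h v) ∈ thetaFunctions Φ (fun (_ : ι → ℤ) (_ : E) ↦ (1 : ℂ)) := by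
    refine ⟨(hh.comp (differentiable_id.add_const u)).sub hh, fun n v ↦ ?_⟩
    show h (v + latticeVec Φ n + u) - h (v + latticeVec Φ n) = 1 * (h (v + u) - h v)
    rw [one_mul, add_right_comm]
    have h1 := hc n (v + u) v
    -- `h(v+u+λ) − h(v+u) = h(v+λ) − h(v)` ⇒ `h(v+u+λ) − h(v+λ) = h(v+u) − h(v)`
    linear_combination h1
  have h := thetaFunction_apply_eq_of_norm_eq_one Φ (ψ := fun _ ↦ (1 : ℂ)) (fun _ ↦ by simp) hq v 0
  simpa only [zero_add] using h

omit [Fintype ι] in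
/-- **Liouville ⇒ affine ℂ-linear**: an entire `h` with constant `Λ`-differences satisfies
`h(v) = h(0) + Dh(0)·v`, `Dh(0)` its (ℂ-linear) Fréchet derivative at `0` (`h − h(0)` is additive and continuous, hence
ℝ-linear and equal to its own derivative, which is ℂ-linear since `h` is holomorphic).
[cite: Lange2023AbelianVarietiesComplex, §1.3.2 Thm. 1.3.3 (Appell–Humbert, p. 30; proof p. 31: Liouville)] -/
theorem apply_eq_apply_zero_add_fderiv_of_forall_latticeVec {h : E → ℂ} (hh : Differentiable ℂ h)
    (hc : ∀ (n : ι → ℤ) (v v' : E), h (v + latticeVec Φ n) - h v = h (v' + latticeVec Φ n) - h v') (v : E) :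
    h v = h 0 + fderiv ℂ h 0 v := by
  -- the additive map `A = h − h(0)`
  have hadd : ∀ u v : E, (h (u + v) - h 0) = (h u - h 0) + (h v - h 0) := fun u v ↦ by
    have := apply_add_sub_apply_eq_of_forall_latticeVec Φ hh hc v u
    linear_combination this
  let A : E →+ ℂ := AddMonoidHom.mk' (fun v ↦ h v - h 0) (fun u v ↦ hadd u v)
  have hAcont : Continuous A := hh.continuous.sub continuous_const
  let Aℝ : E →L[ℝ] ℂ := A.toRealLinearMap hAcont
  have hAℝ : ∀ u, Aℝ u = h u - h 0 := fun _ ↦ rfl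
  -- both `Aℝ` and `(Dh(0)).restrictScalars ℝ` are real derivatives of `h − h(0)` at `0`
  have h1 : HasFDerivAt (fun u ↦ h u - h 0) Aℝ 0 := by
    have := Aℝ.hasFDerivAt (x := 0)
    exact this.congr_of_eventuallyEq (Eventually.of_forall fun u ↦ (hAℝ u).symm) |>.congr_fderiv rfl
  have h2 : HasFDerivAt (fun u ↦ h u - h 0) ((fderiv ℂ h 0).restrictScalars ℝ) 0 :=
    ((hh 0).hasFDerivAt.restrictScalars ℝ).sub_const (h 0)
  have heq : Aℝ = (fderiv ℂ h 0).restrictScalars ℝ := h1.unique h2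
  have := congrArg (fun T : E →L[ℝ] ℂ ↦ T v) heq
  simp only [ContinuousLinearMap.coe_restrictScalars'] at this
  rw [hAℝ] at this
  linear_combination this

/-! ### The first-order cocycle of a translate and the main lemma -/

omit [Fintype ι] in
/-- **The logarithmic derivative of the canonical factor along a translation is the CONSTANT cocycle `π H(w, λ)`**:
`d/ds|₀ a_{(H,χ)}(λ, v + s·w) = a_{(H,χ)}(λ, v) · π H(w, λ)` (from `a(λ, v + w) = a(λ, v) e(π H(w, λ))`, Exercise
1.3.4 (3)(b), and ℂ-linearity of `H` in the first slot) — the first-order variation of `L(H, χ)` under `t_{εw}`.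
[cite: Lange2023AbelianVarietiesComplex, §1.3.4 Exercise (3)(b) (p. 33) and §1.4.4 Thm. 1.4.15 (p. 43)] -/
theorem hasDerivAt_canonicalFactor_translate (η : E [⋀^Fin 2]→L[ℝ] ℝ) (χ : (ι → ℤ) → ℂ) (n : ι → ℤ) (v w : E) :
    HasDerivAt (fun s : ℂ ↦ canonicalFactor Φ η χ n (v + s • w))
      (canonicalFactor Φ η χ n v * (π * hermOf η w (latticeVec Φ n))) 0 := by
  have hf : (fun s : ℂ ↦ canonicalFactor Φ η χ n (v + s • w)) =
      fun s ↦ canonicalFactor Φ η χ n v * cexp (s * (π * hermOf η w (latticeVec Φ n))) := by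
    funext s
    rw [canonicalFactor_add_right, hermOf_smul_left]
    ring_nf
  rw [hf]
  have h1 : HasDerivAt (fun s : ℂ ↦ s * (π * hermOf η w (latticeVec Φ n))) (π * hermOf η w (latticeVec Φ n)) 0 := by
    simpa using (hasDerivAt_id (0 : ℂ)).mul_const (π * hermOf η w (latticeVec Φ n))
  have h2 := (h1.cexp).const_mul (canonicalFactor Φ η χ n v)
  simpa only [zero_mul, Complex.exp_zero, one_mul] using h2

/-- `H(w, ·)` is ℂ-antilinear in the second slot: `H(w, i v) = −i H(w, v)` (for `E = Im H` of type `(1,1)`).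
[cite: Lange2023AbelianVarietiesComplex, §1.2.2 Lemma 1.2.10 (p. 26)] -/
theorem hermOf_I_smul_right (η : E [⋀^Fin 2]→L[ℝ] ℝ) (h11 : ∀ u v : E, η ![I • u, I • v] = η ![u, v]) (w v : E) :
    hermOf η w (I • v) = -I * hermOf η w v := by
  rw [hermOf_swap η h11 (I • v) w, hermOf_I_smul_left, map_mul, Complex.conj_I, ← hermOf_swap η h11 v w]

/-- `H(w, c v) = c H(w, v)` for real `c` (ℝ-homogeneity in the second slot). [cite: Lange2023AbelianVarietiesComplex, §1.2.2 Lemma 1.2.10 (p. 26)] -/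
theorem hermOf_real_smul_right (η : E [⋀^Fin 2]→L[ℝ] ℝ) (c : ℝ) (w v : E) :
    hermOf η w (c • v) = (c : ℂ) * hermOf η w v := by
  simp only [hermOf, twoForm_smul_right, Complex.ofReal_mul]
  ring

/-- **MAIN LEMMA: a Riemann form has no first-order translational symmetry.**  If `η = Im H` is a
Riemann form on `X = V/Λ` (positive definite `H`) and for some `w ∈ V`, `c ≠ 0` and an entire `h` the constant cocycle
`λ ↦ c·H(w, λ)` is the coboundary of `h` — `h(v + λ) − h(v) = c·H(w, λ)` for all `v ∈ V`, `λ ∈ Λ` — then `w = 0`.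
(With `c = π` this says: the first-order deformation `t_{εw}^*L(H,χ) ⊗ L(H,χ)⁻¹` is trivial only for `w = 0`, i.e.
the differential `H(w, ·)` of `φ_L : X → X̂ = Ω̄/Λ̂` (Thm. 1.4.15) is injective.)  Proof: §1 makes `h − h(0)` the
ℂ-linear `ℓ = Dh(0)`; `ℓ` and `c·H(w, ·)` agree on `Λ`, hence on `V` (both ℝ-linear); ℂ-linear = ℂ-antilinear forces
`H(w, ·) = 0`; positivity at `v = w`. [cite: Lange2023AbelianVarietiesComplex, §1.4.4 Thm. 1.4.15 (p. 43) with §1.4.1 Prop. 1.4.1 (p. 36)]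
[cite: MumfordAV1970, §13 (proof of the Thm., p. 125)] -/
theorem IsRiemannForm.eq_zero_of_hermOf_coboundary {η : E [⋀^Fin 2]→L[ℝ] ℝ} (hη : IsRiemannForm Φ η) {w : E}
    {c : ℂ} (hc : c ≠ 0) {h : E → ℂ} (hh : Differentiable ℂ h)
    (hcob : ∀ (n : ι → ℤ) (v : E), h (v + latticeVec Φ n) - h v = c * hermOf η w (latticeVec Φ n)) : w = 0 := by
  classical
  have h11 := hη.1
  -- §1: `h v = h 0 + ℓ v`, `ℓ = Dh(0)` ℂ-linear
  set ℓ : E →L[ℂ] ℂ := fderiv ℂ h 0 with hℓ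
  have haff : ∀ v, h v = h 0 + ℓ v :=
    apply_eq_apply_zero_add_fderiv_of_forall_latticeVec Φ hh (fun n v v' ↦ by rw [hcob, hcob])
  -- `ℓ(λ) = c·H(w, λ)` on the lattice
  have hlat : ∀ n : ι → ℤ, ℓ (latticeVec Φ n) = c * hermOf η w (latticeVec Φ n) := fun n ↦ by
    have := hcob n 0
    rw [zero_add, haff (latticeVec Φ n)] at this
    linear_combination this
  -- hence on all of `V`: compare the two ℝ-linear maps `x ↦ ℓ (Φ x)` and `x ↦ c·H(w, Φ x)` on the standard basis
  let f : (ι → ℝ) →ₗ[ℝ] ℂ := (ℓ.restrictScalars ℝ : E →L[ℝ] ℂ).toLinearMap ∘ₗ (Φ : (ι → ℝ) →L[ℝ] E).toLinearMap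
  let g : (ι → ℝ) →ₗ[ℝ] ℂ :=
    { toFun := fun x ↦ c * hermOf η w (Φ x)
      map_add' := fun x y ↦ by rw [map_add, hermOf_add_right, mul_add]
      map_smul' := fun r x ↦ by
        rw [map_smul, hermOf_real_smul_right, RingHom.id_apply, Complex.real_smul]
        ring }
  have hfg : f = g := by
    refine (Pi.basisFun ℝ ι).ext fun i ↦ ?_
    have hsingle : Φ (Pi.basisFun ℝ ι i) = latticeVec Φ (Pi.single i 1) := by
      rw [Pi.basisFun_apply, latticeVec]
      congr 1
      funext j
      by_cases hj : j = i
      · subst hj; simp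
      · simp [Pi.single_eq_of_ne hj]
    change ℓ (Φ (Pi.basisFun ℝ ι i)) = c * hermOf η w (Φ (Pi.basisFun ℝ ι i))
    rw [hsingle, hlat]
  have hV : ∀ v : E, ℓ v = c * hermOf η w v := fun v ↦ by
    have := congrArg (fun T : (ι → ℝ) →ₗ[ℝ] ℂ ↦ T (Φ.symm v)) hfg
    simpa [f, g] using this
  -- ℂ-linear vs ℂ-antilinear: `H(w, v) = 0` for all `v`
  have hzero : ∀ v : E, hermOf η w v = 0 := fun v ↦ by
    have h1 : ℓ (I • v) = I * ℓ v := by rw [ℓ.map_smul, smul_eq_mul]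
    rw [hV, hV, hermOf_I_smul_right η h11] at h1
    -- `c * (-I * H) = I * (c * H)` ⇒ `2 I c H = 0`
    have h2 : (2 * I * c) * hermOf η w v = 0 := by linear_combination -h1
    rcases mul_eq_zero.1 h2 with h3 | h3
    · exfalso
      exact (mul_ne_zero (mul_ne_zero two_ne_zero Complex.I_ne_zero) hc) h3
    · exact h3
  -- positivity at `v = w`
  by_contra hw
  have hpos := hη.2.2 w hw
  have hre := congrArg Complex.re (hzero w)
  rw [hermOf_re, Complex.zero_re] at hre
  exact (lt_irrefl (0 : ℝ)) (hre ▸ hpos)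

/-- **Coboundary-slack form (any factor equivalent to the canonical one)**: if the first-order cocycle `π H(w, λ)`
plus a coboundary `k(v + λ) − k(v)` (`k` entire — the logarithmic `w`-derivative of the equivalence function `K`) is
itself a coboundary `h(v + λ) − h(v)`, then `w = 0` (the form produced by the frame bookkeeping for the factor of an
arbitrary frame). [cite: Lange2023AbelianVarietiesComplex, §1.2.1 Prop. 1.2.3 (p. 22) and §1.4.4 Thm. 1.4.15 (p. 43)] -/
theorem IsRiemannForm.eq_zero_of_hermOf_add_coboundary {η : E [⋀^Fin 2]→L[ℝ] ℝ} (hη : IsRiemannForm Φ η) {w : E}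
    {c : ℂ} (hc : c ≠ 0) {k h : E → ℂ} (hk : Differentiable ℂ k) (hh : Differentiable ℂ h)
    (hcob : ∀ (n : ι → ℤ) (v : E),
      c * hermOf η w (latticeVec Φ n) + (k (v + latticeVec Φ n) - k v) = h (v + latticeVec Φ n) - h v) :
    w = 0 :=
  hη.eq_zero_of_hermOf_coboundary Φ hc (h := fun v ↦ h v - k v) (hh.sub hk) fun n v ↦ by
    have := hcob n v
    show h (v + latticeVec Φ n) - k (v + latticeVec Φ n) - (h v - k v) = c * hermOf η w (latticeVec Φ n)
    linear_combination (-1 : ℂ) * this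

/-- **First-order rigidity of translations for a positive `L(H, χ)`, derivative form.**  If for some `w ∈ V` there is
an entire `h` with `d/ds|₀ a_{(H,χ)}(λ, v + s·w) = a_{(H,χ)}(λ, v) · (h(v + λ) − h(v))` for all `λ ∈ Λ`, `v ∈ V` — the
first-order translate of the canonical factor is a first-order coboundary — then `w = 0`.
[cite: Lange2023AbelianVarietiesComplex, §1.4.4 Thm. 1.4.15 (p. 43)] [cite: MumfordAV1970, §13 (p. 125)] -/
theorem IsRiemannForm.eq_zero_of_deriv_canonicalFactor_translate_eq {η : E [⋀^Fin 2]→L[ℝ] ℝ}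
    (hη : IsRiemannForm Φ η) (χ : (ι → ℤ) → ℂ) (hχ : IsSemicharacter Φ η χ) {w : E} {h : E → ℂ}
    (hh : Differentiable ℂ h)
    (hder : ∀ (n : ι → ℤ) (v : E),
      deriv (fun s : ℂ ↦ canonicalFactor Φ η χ n (v + s • w)) 0 =
        canonicalFactor Φ η χ n v * (h (v + latticeVec Φ n) - h v)) : w = 0 := by
  refine hη.eq_zero_of_hermOf_coboundary Φ (c := (π : ℂ)) (by exact_mod_cast Real.pi_ne_zero) hh fun n v ↦ ?_
  have h1 := (hasDerivAt_canonicalFactor_translate Φ η χ n v w).deriv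
  rw [hder n v] at h1
  have h0 : canonicalFactor Φ η χ n v ≠ 0 :=
    (isFactor_canonicalFactor Φ hη.isNSForm hχ).ne_zero n v
  exact mul_left_cancel₀ h0 h1.symm |>.symm ▸ rfl

end Heart

/-! ## §2 JUNCTION WITH A COVER: periodic first-order coboundary on (a refinement of) the cover + positive class ⇒ the vector is zero -/

section Junction

variable {ι κ : Type*} [Fintype ι] {E : Type*} [NormedAddCommGroup E] [NormedSpace ℂ E] [FiniteDimensional ℂ E]
  {Φ : (ι → ℝ) ≃L[ℝ] E} {L : HolomorphicLineBundle κ E (ComplexTorus Φ)} {s : κ → E → ℂ}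

/-- **A holomorphic line bundle on `X = V/Λ` with POSITIVE Néron–Severi class has no first-order translational
symmetry visible on (a refinement of) a trivialising cover.**  If `φ₁⁻¹ L = [a_p]` with `p.form` a Riemann form,
`w ∈ V`, `(V_a ⊆ U_{k(a)})_a` an open cover of `X` refining the charts of `L`, and the logarithmic `w`-derivatives of
the transition functions are coboundaries of Λ-periodic holomorphic functions on the refinement pieces
(`∂_w(g_{k(a)k(b)} ∘ π)/(g_{k(a)k(b)} ∘ π) = H_b − H_a` on `π⁻¹(V_a ∩ V_b)`), then `w = 0`.  (Frame bookkeeping turns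
the hypothesis into «`∂_w log e` is a coboundary» for the frame factor `e`; `e ∼ a_p` through an entire zero-free `K`,
whose log-derivative is the coboundary slack; the heart `IsRiemannForm.eq_zero_of_hermOf_add_coboundary` concludes.)
[cite: Lange2023AbelianVarietiesComplex, §1.2.1 Prop. 1.2.3 (p. 22) and §1.4.4 Thm. 1.4.15 (p. 43)] [cite: MumfordAV1970, §13 (p. 125)] -/
theorem IsCoverFrame.eq_zero_of_periodic_firstOrder_coboundary_of_refinement (hs : IsCoverFrame L s) {p : AHData Φ}
    (hp : picClass L = AHData.toPic p) (hR : IsRiemannForm Φ p.form) (w : E)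
    {α : Type*} {V : α → Set (ComplexTorus Φ)} {k : α → κ} (hVU : ∀ a, V a ⊆ L.baseSet (k a))
    (hVo : ∀ a, IsOpen (V a)) (hVc : ∀ x, ∃ a, x ∈ V a) {H : α → E → ℂ}
    (hH : ∀ a, DifferentiableOn ℂ (H a) (cover Φ ⁻¹' V a))
    (hHper : ∀ a (n : ι → ℤ) (z : E), cover Φ z ∈ V a → H a (z + latticeVec Φ n) = H a z)
    (hHcob : ∀ a b (z : E), cover Φ z ∈ V a → cover Φ z ∈ V b →
      fderiv ℂ (fun y ↦ L.coordChange (k a) (k b) (cover Φ y)) z w / L.coordChange (k a) (k b) (cover Φ z) =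
        H b z - H a z) :
    w = 0 := by
  classical
  obtain ⟨F, hF, hFe⟩ := hs.exists_fderiv_div_factorOfFrame_eq_sub_of_refinement w hVU hVo hVc hH hHper hHcob
  -- `e ∼ a_p` through an entire zero-free `K`: `a n v * K v = e n v * K (v + λ)`
  have htriv : (L.tensor (factorLineBundle (AHData.toFactor p).isFactor.inv)).IsTrivialOn Set.univ :=
    (picClass_eq_toPic_iff L (AHData.toFactor p)).1 hp
  obtain ⟨K, hK, hK0, hrel⟩ := exists_coboundary_of_isTrivialOn_tensor_inv_of_isTrivialOn hs.isFactor
    (AHData.toFactor p).isFactor hs.isTrivialOn_tensor_factorLineBundle_inv htriv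
  -- the log-derivative `k` of `K`
  set kK : E → ℂ := fun y ↦ fderiv ℂ K y w / K y with hkdef
  have hk : Differentiable ℂ kK := differentiable_fderiv_apply_div hK hK0 w
  have hane : ∀ n z, canonicalFactor Φ p.form p.char n z ≠ 0 := fun n z ↦
    (isFactor_canonicalFactor Φ p.isNSForm_form p.isSemicharacter_char).ne_zero n z
  have had : ∀ n, Differentiable ℂ (canonicalFactor Φ p.form p.char n) := fun n ↦
    (isFactor_canonicalFactor Φ p.isNSForm_form p.isSemicharacter_char).differentiable n
  have hrel' : ∀ (n : ι → ℤ) (v : E),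
      canonicalFactor Φ p.form p.char n v * K v = factorOfFrame L s n v * K (v + latticeVec Φ n) :=
    fun n v ↦ hrel n v
  -- log-differentiate `a n · K = e n · K(· + λ)` at `z`: `π H(w, λ) + k z = (F z − F (z + λ)) + k (z + λ)`
  have hlog : ∀ (n : ι → ℤ) (z : E),
      (π : ℂ) * hermOf p.form w (latticeVec Φ n) + kK z = (F z - F (z + latticeVec Φ n)) + kK (z + latticeVec Φ n) := by
    intro n z
    have hf1 : (fun v ↦ canonicalFactor Φ p.form p.char n v * K v) =ᶠ[𝓝 z]
        fun v ↦ canonicalFactor Φ p.form p.char n v * K v := Filter.EventuallyEq.rfl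
    have hf2 : (fun v ↦ canonicalFactor Φ p.form p.char n v * K v) =ᶠ[𝓝 z]
        fun v ↦ factorOfFrame L s n v * K (v + latticeVec Φ n) :=
      Filter.Eventually.of_forall fun v ↦ hrel' n v
    have h1 := fderiv_apply_div_eq_add_of_eventuallyEq_mul (g := canonicalFactor Φ p.form p.char n) (h := K) hf1
      (had n z) (hK z) (hane n z) (hK0 z) w
    have h2 := fderiv_apply_div_eq_add_of_eventuallyEq_mul (g := factorOfFrame L s n)
      (h := fun v ↦ K (v + latticeVec Φ n)) hf2 ((hs.isFactor.differentiable n) z)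
      ((hK.comp (differentiable_id.add_const _)) z) (hs.isFactor.ne_zero n z) (hK0 _) w
    rw [fderiv_comp_add_right_apply, hFe n z] at h2
    -- `∂_w a / a = π H(w, λ)`
    have h3 : fderiv ℂ (canonicalFactor Φ p.form p.char n) z w / canonicalFactor Φ p.form p.char n z =
        π * hermOf p.form w (latticeVec Φ n) := by
      have hd := (hasDerivAt_canonicalFactor_translate Φ p.form p.char n z w).deriv
      rw [deriv_comp_line_eq_fderiv (had n z)] at hd
      rw [hd, mul_div_cancel_left₀ _ (hane n z)]
    have h12 := h1.symm.trans h2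
    rw [h3] at h12
    exact h12
  -- the heart, coboundary-slack form with `k' = -k`, `h = -F`
  refine hR.eq_zero_of_hermOf_add_coboundary Φ (c := (π : ℂ)) (by exact_mod_cast Real.pi_ne_zero)
    (k := fun y ↦ -kK y) (h := fun y ↦ -F y) hk.neg hF.neg fun n v ↦ ?_
  have := hlog n v
  linear_combination this

/-- **Cover form** (the case `V_k = U_k`): if `φ₁⁻¹ L = [a_p]` with `p.form` a Riemann form and the logarithmic
`w`-derivatives of the transition functions of `L` are coboundaries of Λ-periodic holomorphic functions on the
trivialising cover (`∂_w(g_{kl} ∘ π)/(g_{kl} ∘ π) = H_l − H_k`), then `w = 0`.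
[cite: Lange2023AbelianVarietiesComplex, §1.2.1 Prop. 1.2.3 (p. 22) and §1.4.4 Thm. 1.4.15 (p. 43)] [cite: MumfordAV1970, §13 (p. 125)] -/
theorem IsCoverFrame.eq_zero_of_periodic_firstOrder_coboundary (hs : IsCoverFrame L s) {p : AHData Φ}
    (hp : picClass L = AHData.toPic p) (hR : IsRiemannForm Φ p.form) (w : E) {H : κ → E → ℂ}
    (hH : ∀ k, DifferentiableOn ℂ (H k) (cover Φ ⁻¹' L.baseSet k))
    (hHper : ∀ k (n : ι → ℤ) (z : E), cover Φ z ∈ L.baseSet k → H k (z + latticeVec Φ n) = H k z)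
    (hHcob : ∀ k l (z : E), cover Φ z ∈ L.baseSet k → cover Φ z ∈ L.baseSet l →
      fderiv ℂ (fun y ↦ L.coordChange k l (cover Φ y)) z w / L.coordChange k l (cover Φ z) = H l z - H k z) :
    w = 0 :=
  hs.eq_zero_of_periodic_firstOrder_coboundary_of_refinement hp hR w (V := L.baseSet) (k := id)
    (fun _ ↦ subset_rfl) L.isOpen_baseSet L.exists_mem_baseSet hH hHper hHcob

end Junction

end ComplexTorus

end Literature.Geometry.Kaehler

end
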